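import Literature.MathematicalPhysics.QuantumFieldTheory.Balaban1983to89.B9Eq3101ConjugationLetters

/-!
# `Balaban1983to89.B9Eq319BumpSection` — T. Bałaban, *Propagators for lattice gauge theories in a background field*, Commun. Math. Phys. **99**
# (1985) 389–434 [Balaban1985BackgroundPropagators] (3.19) p. 393 with (3.35) p. 396 and (3.49) p. 399: **THE BUMP SECTION `Ψ` OF THE ONE-STEP BLOCK
# AVERAGING `Q′(U)` ON THE TORUS — `Q′(Ψg) = g` EXACTLY, `‖D(Ψg)(b)‖ ≤ (ℓ_φ‖c‖ + Φ·hol)‖g(y(b))‖`, and the CONJUGATED letter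
# `Σ_b‖(e^{κχ}(DΨQ′)e^{−κχ})f(b)‖² ≤ d·((ℓ_φ‖c‖ + Φ·hol)e^{‖κ‖ω}M_A)²·Σ_x‖f x‖²` (`C_Ψ`: NO `η`, NO volume, NO window in `κ`)** — route R2′ STEP B8′
# S-P5(b), the (I3)∕kernel-5 letter `C_Ψ`: THE LATTICE PORT of the NE9 crux-ideation seat's KERNEL 6

statement-level skeleton of published theorems with citation tags; proofs where landed; nothing here is a claim about the Yang–Mills mass gap

CITATION HEADER (lean-in-tree rule).  Audit cell `pub-balaban`, sub-cell `t4`, BINDER row NE9; filed by NE9 formalisation-swarm leaf prover 05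
(`b2b-balaban-t4-ne9-formalise-leaf-05`, gen 72) as the PORT, on the tree's lattice objects, of the NE9 crux-ideation seat's abstract finite-graph
KERNEL 6 `t4/ideate/NE9/lens1-NE9BumpSectionLetter.lean` v1 (t4-ne9-idea-1 gen 91, sha16 7f79a1d6e02c49b0; scratch, Mathlib only, never proposed —
CREDIT: every statement and proof idea below is that kernel's; new is only the dress, exactly as in this lineage's port of kernel 1
`B9Eq3101ConjugationLetters`: sites `TSite d (L·m)`, coarse sites `TSite d m`, bonds `Bond = TSite × Fin d` (`bpos`, `btgt`), blocks
`B9Eq319QprimeTorus.blockOf y = {x : blockCoord x = y}`, the tree's `B9Eq33CovDerivVector.covDeriv c R` and `B9Eq319QprimeTorus.QprimeLin` (weight `L^{−d}`,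
contour transports `R(Γ_{y,x}) = pathTr …`)), under the seat's OFFER O-idea1-g91-2 (journal 2026-08-22: «KERNEL 6's lattice instance … first refusal
[this lineage]»).  Source READ in the held text [Balaban1985BackgroundPropagators]: p. 393 (3.19) (the block average with contour transports), p. 396
(3.35) (the regularity class — where the holonomy letter `hol` below is `η`-free), p. 399 (3.49) (the `e^{κχ}` conjugation); the right-inverse device is
NOT print's road (print proves the locality of `R`, `P` by the random-walk expansion Thm 3.2 (3.47)–(3.49)).

WHY (route R2′ STEP B8′ S-P5(b), input (I3) ∕ kernel 5's letter `C_Ψ`).  ne9-leaf-06's kernel-5 port `B9Eq349ConjugatedRangeEnergy` removes kernel 3's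
injectivity hypothesis at the price of ONE letter `C_Ψ = ‖(S_B⁻¹)†(DΨQ̃′)S†‖` built from a right inverse `Ψ` of the averaging.  The centre-supported
section of the tree (`B9Eq319Onto.centreFun`, `Qprime_centreFun`) is a right inverse but its derivative costs `η⁻¹`; the BUMP section spreads `g(y)` over
the block with a profile `φ` normalised to `Σ_{B(y)} L^{−d}φ = 1`, vanishing at both ends of every block-crossing bond, so that `D(Ψg)` carries only the
unit-scale gradient of `φ` and the contour-holonomy defect — both DISPLAYED letters, `η`-free at the point `ηL = 1` under print's class.

WHAT IS PROVED (sorry-free; proof lane — no `def`; the section is written INLINE `x ↦ φ(x)•A⁻¹_{y(x)}(x)(g(y(x)))`, `y(x) = blockCoord x`, with the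
inverse block transports `A⁻¹` a LETTER (`hAinv : R(Γ_{y,x})(A⁻¹_y(x)v) = v`); [folklore] finite sums; nothing of [B9] asserted).
* §1 **`QprimeLin_bumpSection`** — `Q′(Ψg) = g` EXACTLY (`Σ_{B(y)} L^{−d}φ = 1`, transports cancel against their inverses).
* §2 `covDeriv_bumpSection_eq_zero_of_cross`, `covDeriv_bumpSection_eq` (same-block identity: gradient-of-the-bump term + holonomy term),
  **`norm_covDeriv_bumpSection_le`** (`‖D(Ψg)(b)‖ ≤ (‖c‖ℓ_φ + Φ·hol)·M_A′·‖g(y(b₋))‖` from the letters `|φ(b₊) − φ(b₋)| ≤ ℓ_φ` on same-block bonds,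
  `|φ| ≤ Φ`, `‖c‖‖R(b)A⁻¹(b₊)v − A⁻¹(b₋)v‖ ≤ hol‖v‖`, `‖R(b)‖ ≤ M_T`, `‖A⁻¹‖ ≤ M_A′`), `card_bonds_based_in_block` (`d·L^d`),
  **`sum_norm_sq_covDeriv_bumpSection_le`** (`Σ_b‖D(Ψg)(b)‖² ≤ (‖c‖ℓ_φ + Φhol)²M_A′²·dL^d·Σ_y‖g y‖²`).
* §3 `norm_exp_mul_real_le'` (`‖e^{κΔ}‖ ≤ e^{‖κ‖ω}`, NO window), `norm_exp_smul_QprimeLin_le` (`‖e^{κχ(z)}Q′(e^{−κχ}f)(y(z))‖ ≤ e^{‖κ‖ω}M_A L^{−d}Σ_{B}‖f‖`),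
  **`norm_conjExp_DPsiQ_le`**, **`sum_norm_sq_conjExp_DPsiQ_le`** (`Σ_b‖(e^{κχ}(DΨQ′)e^{−κχ})f(b)‖² ≤ d·((‖c‖ℓ_φ + Φhol)M_A′e^{‖κ‖ω}M_A)²·Σ_x‖f x‖²` — the
  `L^{−2d}·L^d·dL^d = d` cancellation; equal site∕bond weights `c₀` cancel: this IS `C_Ψ²` on the chain's carriers).
HONEST SCOPE.  Letters DISPLAYED, not produced: the bump `φ` (existence of a profile with `Σ_{B(y)}L^{−d}φ = 1` vanishing on block boundaries needs `L ≥ 3`;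
its unit-scale gradient `‖c‖ℓ_φ = O(1)` at `ηL = 1`), the inverse block transports `A⁻¹` and their bound, the holonomy letter `hol` (`= ‖c‖·‖U(ladder loop) − 1‖`,
`η`-free exactly under the plaquette class (3.35), NOT from `‖U(b) − 1‖ ≤ αη` alone — idea-1's caveat), `M_T`, `M_A`; NO decay, NO number, NO projection;
ONE input letter of one sub-step of a route step, NOT NE9 (cell pub-balaban: NE9 NOT PRINTED ∕ NOT PROVED; «NE9 ⇐ the named binders»; spine PROVED 0∕9;
rung (B)+1 on a finite T⁴ — NOT infinite volume, NOT mass gap, NOT Clay; HONEST DEPENDENCY: continuum YM on T⁴ ⇐ BetaPertH ∧ nine spine estimates (0/9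
proved); BetaPertH ⇐ (D1) ∧ (D4) ∧ CAP+tail; G-an2-4 gates asym, D1 and NE2/3/4).  NEW file importing `B9Eq3101ConjugationLetters` only; nothing modified.
Net new unproved facts: 0.
-/

noncomputable section

open Finset

namespace Literature.MathematicalPhysics.QuantumFieldTheory.Balaban1983to89.B9Eq319BumpSection

open B4Sect5Torus (TSite)
open B9SectCLatticeCarrier (Bond bpos btgt shift)
open B9Eq33CovDerivVector (covDeriv covDeriv_apply)
open B9Eq323Ker (pathTr)
open B9Eq319QprimeTorus (fineP centre blockCoord contour stepTransport QprimeLin)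
open B9Eq319QprimeLipschitz (sum_blockOf_sum)
open B5Eq172FlatCoercivity (card_blockOf)
open B9Eq3101ConjugationLetters (QprimeLin_apply_eq_sum pathTr_stepTransport_smul exp_mul_exp_neg_eq_exp_sub)

variable {d : ℕ} (L : ℕ) [NeZero L] (m : Fin d → ℕ) {V : Type*} [NormedAddCommGroup V] [NormedSpace ℂ V]

/-! ## §1 The bump section is an exact right inverse of `Q′` -/

/-- **`Q′(Ψg) = g` EXACTLY.** For inverse block transports `A⁻¹_y(x)` (`R(Γ_{y,x})(A⁻¹_y(x)v) = v` on `x ∈ B(y)`) and a profile with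
`Σ_{x∈B(y)} L^{−d}φ(x) = 1`: the section `x ↦ φ(x)•A⁻¹_{y(x)}(x)(g(y(x)))`, `y(x) = blockCoord x`, is averaged back to `g`. [folklore]
[cite: Balaban1985BackgroundPropagators, (3.19) p.393] -/
theorem QprimeLin_bumpSection (Rb : Bond d (fineP L m) → V →ₗ[ℂ] V) (Ainv : TSite d m → TSite d (fineP L m) → V →ₗ[ℂ] V)
    (hAinv : ∀ (y : TSite d m), ∀ x ∈ B9Eq319QprimeTorus.blockOf L m y, ∀ v : V,
      pathTr (stepTransport L m fun b => (Rb b).restrictScalars ℝ) (centre L m y :: contour L m x) (Ainv y x v) = v)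
    (φ : TSite d (fineP L m) → ℝ) (hφ : ∀ y : TSite d m, ∑ x ∈ B9Eq319QprimeTorus.blockOf L m y, ((L : ℝ) ^ d)⁻¹ * φ x = 1)
    (g : TSite d m → V) (y : TSite d m) :
    QprimeLin L m Rb (fun x => (φ x : ℂ) • Ainv (blockCoord L m x) x (g (blockCoord L m x))) y = g y := by
  rw [QprimeLin_apply_eq_sum]
  have key : ∀ x ∈ B9Eq319QprimeTorus.blockOf L m y,
      ((L : ℝ) ^ d)⁻¹ • pathTr (stepTransport L m fun b => (Rb b).restrictScalars ℝ) (centre L m y :: contour L m x)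
        ((φ x : ℂ) • Ainv (blockCoord L m x) x (g (blockCoord L m x))) = (((L : ℝ) ^ d)⁻¹ * φ x) • g y := by
    intro x hx
    have hxy : blockCoord L m x = y := (B9Eq319QprimeTorus.mem_blockOf_iff L m y x).1 hx
    rw [pathTr_stepTransport_smul, hxy, hAinv y x hx, Complex.coe_smul, smul_smul]
  rw [sum_congr rfl key, ← sum_smul, hφ y, one_smul]

/-! ## §2 The covariant derivative of the section -/

omit [NeZero L] in
/-- A bond at whose two ends the bump vanishes carries no derivative of the section (block-crossing bonds). [folklore]
[cite: Balaban1985BackgroundPropagators, (3.19) p.393, (3.3) pp.390–391] -/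
theorem covDeriv_bumpSection_eq_zero_of_cross (c : ℂ) (R : Bond d (fineP L m) → V →ₗ[ℂ] V)
    (Ainv : TSite d m → TSite d (fineP L m) → V →ₗ[ℂ] V) {φ : TSite d (fineP L m) → ℝ} {b : Bond d (fineP L m)} (h0s : φ (bpos b) = 0)
    (h0t : φ (btgt b) = 0) (g : TSite d m → V) :
    covDeriv c R (fun x => (φ x : ℂ) • Ainv (blockCoord L m x) x (g (blockCoord L m x))) b = 0 := by
  simp [covDeriv_apply, h0s, h0t]

omit [NeZero L] in
/-- **SAME-BLOCK IDENTITY.** On a bond with both ends in the block `y`: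
`D(Ψg)(b) = (c(φ(b₊) − φ(b₋)))•R(b)A⁻¹_y(b₊)g(y) + φ(b₋)•(c•(R(b)A⁻¹_y(b₊)g(y) − A⁻¹_y(b₋)g(y)))` — a gradient-of-the-bump term and a contour-holonomy term.
[folklore] [cite: Balaban1985BackgroundPropagators, (3.19) p.393, (3.3) pp.390–391] -/
theorem covDeriv_bumpSection_eq (c : ℂ) (R : Bond d (fineP L m) → V →ₗ[ℂ] V) (Ainv : TSite d m → TSite d (fineP L m) → V →ₗ[ℂ] V)
    (φ : TSite d (fineP L m) → ℝ) (g : TSite d m → V) {b : Bond d (fineP L m)} {y : TSite d m} (hs : blockCoord L m (bpos b) = y)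
    (ht : blockCoord L m (btgt b) = y) :
    covDeriv c R (fun x => (φ x : ℂ) • Ainv (blockCoord L m x) x (g (blockCoord L m x))) b =
      (c * ((φ (btgt b) - φ (bpos b) : ℝ) : ℂ)) • R b (Ainv y (btgt b) (g y)) +
        (φ (bpos b) : ℂ) • (c • (R b (Ainv y (btgt b) (g y)) - Ainv y (bpos b) (g y))) := by
  simp only [covDeriv_apply, hs, ht, map_smul]
  push_cast
  module

omit [NeZero L] in
variable {L m} in
/-- **POINTWISE BOUND — the letters DISPLAYED.** With `|φ(b₊) − φ(b₋)| ≤ ℓ_φ` on same-block bonds, `|φ| ≤ Φ`, transporters `‖R(b)v‖ ≤ M_T‖v‖`,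
inverse block transports `‖A⁻¹_y(x)v‖ ≤ M_A′‖v‖`, the contour-holonomy defect `‖c‖·‖R(b)A⁻¹_y(b₊)v − A⁻¹_y(b₋)v‖ ≤ hol·‖v‖` on same-block bonds, and
`φ = 0` at both ends of every crossing bond: `‖D(Ψg)(b)‖ ≤ (‖c‖ℓ_φM_TM_A′ + Φ·hol)·‖g(y(b₋))‖` for EVERY bond. [folklore]
[cite: Balaban1985BackgroundPropagators, (3.19) p.393, (3.35) p.396] -/
theorem norm_covDeriv_bumpSection_le {c : ℂ} {ℓφ Φ hol MT MA' : ℝ} (hMT : 0 ≤ MT) (hMA' : 0 ≤ MA') {R : Bond d (fineP L m) → V →ₗ[ℂ] V}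
    (hR : ∀ b v, ‖R b v‖ ≤ MT * ‖v‖) {Ainv : TSite d m → TSite d (fineP L m) → V →ₗ[ℂ] V} (hAinvN : ∀ y x v, ‖Ainv y x v‖ ≤ MA' * ‖v‖)
    {φ : TSite d (fineP L m) → ℝ} (hφlip : ∀ b : Bond d (fineP L m), blockCoord L m (btgt b) = blockCoord L m (bpos b) → |φ (btgt b) - φ (bpos b)| ≤ ℓφ)
    (hℓφ : 0 ≤ ℓφ) (hΦ : ∀ x, |φ x| ≤ Φ) (hhol0 : 0 ≤ hol)
    (hhol : ∀ (b : Bond d (fineP L m)) (v : V), blockCoord L m (btgt b) = blockCoord L m (bpos b) →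
      ‖c‖ * ‖R b (Ainv (blockCoord L m (bpos b)) (btgt b) v) - Ainv (blockCoord L m (bpos b)) (bpos b) v‖ ≤ hol * ‖v‖)
    (hcross : ∀ b : Bond d (fineP L m), blockCoord L m (btgt b) ≠ blockCoord L m (bpos b) → φ (bpos b) = 0 ∧ φ (btgt b) = 0)
    (g : TSite d m → V) (b : Bond d (fineP L m)) :
    ‖covDeriv c R (fun x => (φ x : ℂ) • Ainv (blockCoord L m x) x (g (blockCoord L m x))) b‖ ≤
      (‖c‖ * ℓφ * MT * MA' + Φ * hol) * ‖g (blockCoord L m (bpos b))‖ := by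
  have hΦ0 : 0 ≤ Φ := (abs_nonneg _).trans (hΦ (bpos b))
  by_cases hb : blockCoord L m (btgt b) = blockCoord L m (bpos b)
  · set y := blockCoord L m (bpos b) with hy
    have hX : ‖R b (Ainv y (btgt b) (g y))‖ ≤ MT * (MA' * ‖g y‖) :=
      (hR b _).trans (mul_le_mul_of_nonneg_left (hAinvN _ _ _) hMT)
    have h1 : ‖(c * ((φ (btgt b) - φ (bpos b) : ℝ) : ℂ)) • R b (Ainv y (btgt b) (g y))‖ ≤ ‖c‖ * ℓφ * MT * MA' * ‖g y‖ := by
      rw [norm_smul, norm_mul, Complex.norm_real, Real.norm_eq_abs]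
      calc ‖c‖ * |φ (btgt b) - φ (bpos b)| * ‖R b (Ainv y (btgt b) (g y))‖ ≤ ‖c‖ * ℓφ * (MT * (MA' * ‖g y‖)) :=
            mul_le_mul (mul_le_mul_of_nonneg_left (hφlip b hb) (norm_nonneg c)) hX (norm_nonneg _) (by positivity)
        _ = ‖c‖ * ℓφ * MT * MA' * ‖g y‖ := by ring
    have h2 : ‖(φ (bpos b) : ℂ) • (c • (R b (Ainv y (btgt b) (g y)) - Ainv y (bpos b) (g y)))‖ ≤ Φ * (hol * ‖g y‖) := by
      rw [norm_smul, Complex.norm_real, Real.norm_eq_abs, norm_smul]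
      exact mul_le_mul (hΦ (bpos b)) (hhol b (g y) hb) (by positivity) hΦ0
    rw [covDeriv_bumpSection_eq L m c R Ainv φ g rfl hb]
    calc _ ≤ _ := norm_add_le _ _
      _ ≤ ‖c‖ * ℓφ * MT * MA' * ‖g y‖ + Φ * (hol * ‖g y‖) := add_le_add h1 h2
      _ = (‖c‖ * ℓφ * MT * MA' + Φ * hol) * ‖g y‖ := by ring
  · obtain ⟨h0s, h0t⟩ := hcross b hb
    rw [covDeriv_bumpSection_eq_zero_of_cross L m c R Ainv h0s h0t, norm_zero]
    have : 0 ≤ ‖c‖ * ℓφ * MT * MA' := by positivity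
    positivity

/-- The bonds based in one block: `#{b : y(b₋) = y} = d·L^d`. [folklore] [cite: Balaban1985Averaging, (2) p.17] -/
theorem card_bonds_based_in_block (y : TSite d m) :
    (univ.filter fun b : Bond d (fineP L m) => blockCoord L m (bpos b) = y).card = d * L ^ d := by
  have e : (univ.filter fun b : Bond d (fineP L m) => blockCoord L m (bpos b) = y) =
      (B9Eq319QprimeTorus.blockOf L m y) ×ˢ (univ : Finset (Fin d)) := by
    ext b
    simp [B9Eq319QprimeTorus.blockOf, bpos]
  rw [e, card_product, card_blockOf, card_univ, Fintype.card_fin, Nat.mul_comm]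

variable {L m} in
/-- **`ℓ²` BOUND for `DΨ`:** `Σ_b ‖D(Ψg)(b)‖² ≤ (‖c‖ℓ_φM_TM_A′ + Φhol)²·(dL^d)·Σ_y ‖g y‖²` (every coarse site is `y(b₋)` for exactly `dL^d` bonds).
[folklore] [cite: Balaban1985BackgroundPropagators, (3.19) p.393; Balaban1985Averaging, (2)–(4) pp.17–18] -/
theorem sum_norm_sq_covDeriv_bumpSection_le {c : ℂ} {ℓφ Φ hol MT MA' : ℝ} (hMT : 0 ≤ MT) (hMA' : 0 ≤ MA') {R : Bond d (fineP L m) → V →ₗ[ℂ] V}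
    (hR : ∀ b v, ‖R b v‖ ≤ MT * ‖v‖) {Ainv : TSite d m → TSite d (fineP L m) → V →ₗ[ℂ] V} (hAinvN : ∀ y x v, ‖Ainv y x v‖ ≤ MA' * ‖v‖)
    {φ : TSite d (fineP L m) → ℝ} (hφlip : ∀ b : Bond d (fineP L m), blockCoord L m (btgt b) = blockCoord L m (bpos b) → |φ (btgt b) - φ (bpos b)| ≤ ℓφ)
    (hℓφ : 0 ≤ ℓφ) (hΦ : ∀ x, |φ x| ≤ Φ) (hhol0 : 0 ≤ hol)
    (hhol : ∀ (b : Bond d (fineP L m)) (v : V), blockCoord L m (btgt b) = blockCoord L m (bpos b) →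
      ‖c‖ * ‖R b (Ainv (blockCoord L m (bpos b)) (btgt b) v) - Ainv (blockCoord L m (bpos b)) (bpos b) v‖ ≤ hol * ‖v‖)
    (hcross : ∀ b : Bond d (fineP L m), blockCoord L m (btgt b) ≠ blockCoord L m (bpos b) → φ (bpos b) = 0 ∧ φ (btgt b) = 0)
    (g : TSite d m → V) :
    ∑ b : Bond d (fineP L m), ‖covDeriv c R (fun x => (φ x : ℂ) • Ainv (blockCoord L m x) x (g (blockCoord L m x))) b‖ ^ 2 ≤
      (‖c‖ * ℓφ * MT * MA' + Φ * hol) ^ 2 * (d * (L : ℝ) ^ d) * ∑ y, ‖g y‖ ^ 2 := by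
  set K : ℝ := ‖c‖ * ℓφ * MT * MA' + Φ * hol with hK
  have hfib : ∑ b : Bond d (fineP L m), ‖g (blockCoord L m (bpos b))‖ ^ 2 = (d * (L : ℝ) ^ d) * ∑ y, ‖g y‖ ^ 2 := by
    rw [← Finset.sum_fiberwise univ (fun b : Bond d (fineP L m) => blockCoord L m (bpos b)) (fun b => ‖g (blockCoord L m (bpos b))‖ ^ 2), mul_sum]
    refine sum_congr rfl fun y _ => ?_
    rw [sum_congr rfl fun b hb => by rw [(mem_filter.1 hb).2], sum_const, card_bonds_based_in_block L m y, nsmul_eq_mul]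
    push_cast; ring
  calc ∑ b : Bond d (fineP L m), ‖covDeriv c R (fun x => (φ x : ℂ) • Ainv (blockCoord L m x) x (g (blockCoord L m x))) b‖ ^ 2
      ≤ ∑ b : Bond d (fineP L m), K ^ 2 * ‖g (blockCoord L m (bpos b))‖ ^ 2 := by
        refine sum_le_sum fun b _ => ?_
        have h := norm_covDeriv_bumpSection_le hMT hMA' hR hAinvN hφlip hℓφ hΦ hhol0 hhol hcross g b
        have h0 : 0 ≤ K * ‖g (blockCoord L m (bpos b))‖ := le_trans (norm_nonneg _) h
        calc _ ≤ (K * ‖g (blockCoord L m (bpos b))‖) ^ 2 := pow_le_pow_left₀ (norm_nonneg _) h 2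
          _ = K ^ 2 * ‖g (blockCoord L m (bpos b))‖ ^ 2 := by ring
    _ = K ^ 2 * (d * (L : ℝ) ^ d) * ∑ y, ‖g y‖ ^ 2 := by rw [← mul_sum, hfib]; ring

/-! ## §3 The conjugated letter `C_Ψ`: `e^{κχ}(DΨQ′)e^{−κχ}` — no window in `κ` -/

omit [NeZero L] in
/-- `‖e^{κΔ}‖ ≤ e^{‖κ‖ω}` for `|Δ| ≤ ω` — NO window in `κ`. [folklore] [cite: Balaban1985BackgroundPropagators, (3.49) p.399] -/
theorem norm_exp_mul_real_le' {κ : ℂ} {Δ ω : ℝ} (hΔ : |Δ| ≤ ω) : ‖Complex.exp (κ * (Δ : ℂ))‖ ≤ Real.exp (‖κ‖ * ω) := by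
  rw [Complex.norm_exp]
  refine Real.exp_le_exp.mpr ?_
  calc (κ * (Δ : ℂ)).re ≤ ‖κ * (Δ : ℂ)‖ := Complex.re_le_norm _
    _ = ‖κ‖ * |Δ| := by rw [norm_mul, Complex.norm_real, Real.norm_eq_abs]
    _ ≤ ‖κ‖ * ω := mul_le_mul_of_nonneg_left hΔ (norm_nonneg κ)

variable {L m} in
/-- The conjugated block average read at a fine site `z`: with `|χ z − χ x| ≤ ω` over the block of `z` (`ω` = oscillation of `χ` over ONE block) and
contour transports `≤ M_A`: `‖e^{κχ(z)}•Q′(e^{−κχ}f)(y(z))‖ ≤ e^{‖κ‖ω}·M_A·L^{−d}·Σ_{x∈B(y(z))}‖f x‖`. [folklore]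
[cite: Balaban1985BackgroundPropagators, (3.19) p.393, (3.49) p.399] -/
theorem norm_exp_smul_QprimeLin_le {ω MA : ℝ} (Rb : Bond d (fineP L m) → V →ₗ[ℂ] V)
    (hA : ∀ (y : TSite d m), ∀ x ∈ B9Eq319QprimeTorus.blockOf L m y, ∀ v : V,
      ‖pathTr (stepTransport L m fun b => (Rb b).restrictScalars ℝ) (centre L m y :: contour L m x) v‖ ≤ MA * ‖v‖)
    {κ : ℂ} {χ : TSite d (fineP L m) → ℝ} {z : TSite d (fineP L m)}
    (hω : ∀ x, blockCoord L m x = blockCoord L m z → |χ z - χ x| ≤ ω) (f : TSite d (fineP L m) → V) :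
    ‖Complex.exp (κ * (χ z : ℂ)) • QprimeLin L m Rb (fun x => Complex.exp (-(κ * (χ x : ℂ))) • f x) (blockCoord L m z)‖ ≤
      Real.exp (‖κ‖ * ω) * MA * (((L : ℝ) ^ d)⁻¹ * ∑ x ∈ B9Eq319QprimeTorus.blockOf L m (blockCoord L m z), ‖f x‖) := by
  have hw : 0 ≤ ((L : ℝ) ^ d)⁻¹ := by positivity
  rw [QprimeLin_apply_eq_sum, smul_sum, mul_sum, mul_sum]
  refine (norm_sum_le _ _).trans (sum_le_sum fun x hx => ?_)
  have hxc : blockCoord L m x = blockCoord L m z := (B9Eq319QprimeTorus.mem_blockOf_iff L m _ x).1 hx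
  have hP : ‖Complex.exp (κ * (χ z : ℂ))‖ * ‖Complex.exp (-(κ * (χ x : ℂ)))‖ ≤ Real.exp (‖κ‖ * ω) := by
    rw [← norm_mul, exp_mul_exp_neg_eq_exp_sub κ χ χ z x]
    exact norm_exp_mul_real_le' (hω x hxc)
  have hAx := hA (blockCoord L m z) x hx (f x)
  rw [pathTr_stepTransport_smul, norm_smul, norm_smul, norm_smul, norm_inv, norm_pow, Real.norm_natCast]
  calc ‖Complex.exp (κ * (χ z : ℂ))‖ * (((L : ℝ) ^ d)⁻¹ * (‖Complex.exp (-(κ * (χ x : ℂ)))‖ *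
        ‖pathTr (stepTransport L m fun b => (Rb b).restrictScalars ℝ) (centre L m (blockCoord L m z) :: contour L m x) (f x)‖))
      = (‖Complex.exp (κ * (χ z : ℂ))‖ * ‖Complex.exp (-(κ * (χ x : ℂ)))‖) * (((L : ℝ) ^ d)⁻¹ *
        ‖pathTr (stepTransport L m fun b => (Rb b).restrictScalars ℝ) (centre L m (blockCoord L m z) :: contour L m x) (f x)‖) := by ring
    _ ≤ Real.exp (‖κ‖ * ω) * (((L : ℝ) ^ d)⁻¹ * (MA * ‖f x‖)) :=
        mul_le_mul hP (mul_le_mul_of_nonneg_left hAx hw) (by positivity) (by positivity)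
    _ = Real.exp (‖κ‖ * ω) * MA * (((L : ℝ) ^ d)⁻¹ * ‖f x‖) := by ring

variable {L m} in
/-- **POINTWISE BOUND for the conjugated `DΨQ′`:** for `X f = D(Ψ(Q′f))` and the weights `e^{κχ}` (outside, at `b₋`), `e^{−κχ}` (inside):
`‖e^{κχ(b₋)}•X(e^{−κχ}f)(b)‖ ≤ (‖c‖ℓ_φM_TM_A′ + Φhol)·e^{‖κ‖ω}M_A·L^{−d}Σ_{x∈B(y(b₋))}‖f x‖` — the outside weight passes through the LOCAL map `DΨ` (a scalar)
and meets the inside weight within ONE block; NO window in `κ`. [folklore] [cite: Balaban1985BackgroundPropagators, (3.19) p.393, (3.49) p.399] -/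
theorem norm_conjExp_DPsiQ_le {c : ℂ} {ℓφ Φ hol MT MA' ω MA : ℝ} (hMT : 0 ≤ MT) (hMA' : 0 ≤ MA')
    {R : Bond d (fineP L m) → V →ₗ[ℂ] V} (hR : ∀ b v, ‖R b v‖ ≤ MT * ‖v‖)
    (hA : ∀ (y : TSite d m), ∀ x ∈ B9Eq319QprimeTorus.blockOf L m y, ∀ v : V,
      ‖pathTr (stepTransport L m fun b => (R b).restrictScalars ℝ) (centre L m y :: contour L m x) v‖ ≤ MA * ‖v‖)
    {Ainv : TSite d m → TSite d (fineP L m) → V →ₗ[ℂ] V} (hAinvN : ∀ y x v, ‖Ainv y x v‖ ≤ MA' * ‖v‖)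
    {φ : TSite d (fineP L m) → ℝ} (hφlip : ∀ b : Bond d (fineP L m), blockCoord L m (btgt b) = blockCoord L m (bpos b) → |φ (btgt b) - φ (bpos b)| ≤ ℓφ)
    (hℓφ : 0 ≤ ℓφ) (hΦ : ∀ x, |φ x| ≤ Φ) (hhol0 : 0 ≤ hol)
    (hhol : ∀ (b : Bond d (fineP L m)) (v : V), blockCoord L m (btgt b) = blockCoord L m (bpos b) →
      ‖c‖ * ‖R b (Ainv (blockCoord L m (bpos b)) (btgt b) v) - Ainv (blockCoord L m (bpos b)) (bpos b) v‖ ≤ hol * ‖v‖)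
    (hcross : ∀ b : Bond d (fineP L m), blockCoord L m (btgt b) ≠ blockCoord L m (bpos b) → φ (bpos b) = 0 ∧ φ (btgt b) = 0)
    {κ : ℂ} {χ : TSite d (fineP L m) → ℝ} (hω : ∀ (b : Bond d (fineP L m)) (x : TSite d (fineP L m)),
      blockCoord L m x = blockCoord L m (bpos b) → |χ (bpos b) - χ x| ≤ ω)
    (f : TSite d (fineP L m) → V) (b : Bond d (fineP L m)) :
    ‖Complex.exp (κ * (χ (bpos b) : ℂ)) • covDeriv c R (fun x => (φ x : ℂ) • Ainv (blockCoord L m x) x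
        (QprimeLin L m R (fun z => Complex.exp (-(κ * (χ z : ℂ))) • f z) (blockCoord L m x))) b‖ ≤
      (‖c‖ * ℓφ * MT * MA' + Φ * hol) * (Real.exp (‖κ‖ * ω) * MA *
        (((L : ℝ) ^ d)⁻¹ * ∑ x ∈ B9Eq319QprimeTorus.blockOf L m (blockCoord L m (bpos b)), ‖f x‖)) := by
  have hD := norm_covDeriv_bumpSection_le hMT hMA' hR hAinvN hφlip hℓφ hΦ hhol0 hhol hcross
    (QprimeLin L m R (fun z => Complex.exp (-(κ * (χ z : ℂ))) • f z)) b
  have hQ := norm_exp_smul_QprimeLin_le R hA (κ := κ) (hω b) f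
  have hC : 0 ≤ ‖c‖ * ℓφ * MT * MA' + Φ * hol := by
    have : 0 ≤ Φ := (abs_nonneg _).trans (hΦ (bpos b))
    positivity
  rw [norm_smul]
  calc ‖Complex.exp (κ * (χ (bpos b) : ℂ))‖ * ‖covDeriv c R (fun x => (φ x : ℂ) • Ainv (blockCoord L m x) x
          (QprimeLin L m R (fun z => Complex.exp (-(κ * (χ z : ℂ))) • f z) (blockCoord L m x))) b‖
      ≤ ‖Complex.exp (κ * (χ (bpos b) : ℂ))‖ * ((‖c‖ * ℓφ * MT * MA' + Φ * hol) *
          ‖QprimeLin L m R (fun z => Complex.exp (-(κ * (χ z : ℂ))) • f z) (blockCoord L m (bpos b))‖) :=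
        mul_le_mul_of_nonneg_left hD (norm_nonneg _)
    _ = (‖c‖ * ℓφ * MT * MA' + Φ * hol) * ‖Complex.exp (κ * (χ (bpos b) : ℂ)) •
          QprimeLin L m R (fun z => Complex.exp (-(κ * (χ z : ℂ))) • f z) (blockCoord L m (bpos b))‖ := by rw [norm_smul]; ring
    _ ≤ _ := mul_le_mul_of_nonneg_left hQ hC

variable {L m} in
/-- **`ℓ²` BOUND — THE LETTER `C_Ψ`, NO `η`, NO VOLUME, NO WINDOW IN `κ`:**
`Σ_b ‖e^{κχ(b₋)}•(DΨQ′)(e^{−κχ}f)(b)‖² ≤ d·((‖c‖ℓ_φM_TM_A′ + Φhol)·e^{‖κ‖ω}·M_A)²·Σ_x ‖f x‖²` — Jensen on each block (`|B| = L^d`), then every coarse site is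
`y(b₋)` for exactly `dL^d` bonds: `L^{−2d}·L^d·dL^d = d`.  Equal site∕bond weights `c₀` of the chain's carriers cancel, so this is `C_Ψ²·‖f‖²`.
[folklore] [cite: Balaban1985BackgroundPropagators, (3.19) p.393, (3.49) p.399, (3.11) p.392] -/
theorem sum_norm_sq_conjExp_DPsiQ_le {c : ℂ} {ℓφ Φ hol MT MA' ω MA : ℝ} (hMT : 0 ≤ MT) (hMA' : 0 ≤ MA')
    {R : Bond d (fineP L m) → V →ₗ[ℂ] V} (hR : ∀ b v, ‖R b v‖ ≤ MT * ‖v‖)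
    (hA : ∀ (y : TSite d m), ∀ x ∈ B9Eq319QprimeTorus.blockOf L m y, ∀ v : V,
      ‖pathTr (stepTransport L m fun b => (R b).restrictScalars ℝ) (centre L m y :: contour L m x) v‖ ≤ MA * ‖v‖)
    {Ainv : TSite d m → TSite d (fineP L m) → V →ₗ[ℂ] V} (hAinvN : ∀ y x v, ‖Ainv y x v‖ ≤ MA' * ‖v‖)
    {φ : TSite d (fineP L m) → ℝ} (hφlip : ∀ b : Bond d (fineP L m), blockCoord L m (btgt b) = blockCoord L m (bpos b) → |φ (btgt b) - φ (bpos b)| ≤ ℓφ)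
    (hℓφ : 0 ≤ ℓφ) (hΦ : ∀ x, |φ x| ≤ Φ) (hhol0 : 0 ≤ hol)
    (hhol : ∀ (b : Bond d (fineP L m)) (v : V), blockCoord L m (btgt b) = blockCoord L m (bpos b) →
      ‖c‖ * ‖R b (Ainv (blockCoord L m (bpos b)) (btgt b) v) - Ainv (blockCoord L m (bpos b)) (bpos b) v‖ ≤ hol * ‖v‖)
    (hcross : ∀ b : Bond d (fineP L m), blockCoord L m (btgt b) ≠ blockCoord L m (bpos b) → φ (bpos b) = 0 ∧ φ (btgt b) = 0)
    {κ : ℂ} {χ : TSite d (fineP L m) → ℝ} (hω : ∀ (b : Bond d (fineP L m)) (x : TSite d (fineP L m)),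
      blockCoord L m x = blockCoord L m (bpos b) → |χ (bpos b) - χ x| ≤ ω)
    (f : TSite d (fineP L m) → V) :
    ∑ b : Bond d (fineP L m), ‖Complex.exp (κ * (χ (bpos b) : ℂ)) • covDeriv c R (fun x => (φ x : ℂ) • Ainv (blockCoord L m x) x
        (QprimeLin L m R (fun z => Complex.exp (-(κ * (χ z : ℂ))) • f z) (blockCoord L m x))) b‖ ^ 2 ≤
      d * ((‖c‖ * ℓφ * MT * MA' + Φ * hol) * Real.exp (‖κ‖ * ω) * MA) ^ 2 * ∑ x, ‖f x‖ ^ 2 := by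
  set K : ℝ := (‖c‖ * ℓφ * MT * MA' + Φ * hol) * Real.exp (‖κ‖ * ω) * MA with hK
  set G : TSite d m → ℝ := fun y => ((L : ℝ) ^ d)⁻¹ * ∑ x ∈ B9Eq319QprimeTorus.blockOf L m y, ‖f x‖ ^ 2 with hG
  have hL : (0 : ℝ) < (L : ℝ) ^ d := by
    have : (0 : ℝ) < L := by exact_mod_cast Nat.pos_of_ne_zero (NeZero.ne L)
    positivity
  have key : ∀ b : Bond d (fineP L m), ‖Complex.exp (κ * (χ (bpos b) : ℂ)) • covDeriv c R (fun x => (φ x : ℂ) • Ainv (blockCoord L m x) x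
        (QprimeLin L m R (fun z => Complex.exp (-(κ * (χ z : ℂ))) • f z) (blockCoord L m x))) b‖ ^ 2 ≤ K ^ 2 * G (blockCoord L m (bpos b)) := by
    intro b
    have h := norm_conjExp_DPsiQ_le hMT hMA' hR hA hAinvN hφlip hℓφ hΦ hhol0 hhol hcross (κ := κ) hω f b
    have h' : ‖Complex.exp (κ * (χ (bpos b) : ℂ)) • covDeriv c R (fun x => (φ x : ℂ) • Ainv (blockCoord L m x) x
        (QprimeLin L m R (fun z => Complex.exp (-(κ * (χ z : ℂ))) • f z) (blockCoord L m x))) b‖ ≤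
        K * (((L : ℝ) ^ d)⁻¹ * ∑ x ∈ B9Eq319QprimeTorus.blockOf L m (blockCoord L m (bpos b)), ‖f x‖) := by
      refine h.trans (le_of_eq ?_); rw [hK]; ring
    have hJ := B9Eq319QprimeLipschitz.blockMean_norm_sq_le L m f (blockCoord L m (bpos b))
    calc _ ≤ (K * (((L : ℝ) ^ d)⁻¹ * ∑ x ∈ B9Eq319QprimeTorus.blockOf L m (blockCoord L m (bpos b)), ‖f x‖)) ^ 2 :=
          pow_le_pow_left₀ (norm_nonneg _) h' 2
      _ = K ^ 2 * (((L : ℝ) ^ d)⁻¹ * ∑ x ∈ B9Eq319QprimeTorus.blockOf L m (blockCoord L m (bpos b)), ‖f x‖) ^ 2 := by ring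
      _ ≤ K ^ 2 * G (blockCoord L m (bpos b)) := mul_le_mul_of_nonneg_left hJ (sq_nonneg _)
  have hG0 : ∀ y, 0 ≤ G y := fun y => by rw [hG]; positivity
  have hfib : ∑ b : Bond d (fineP L m), G (blockCoord L m (bpos b)) = (d * (L : ℝ) ^ d) * ∑ y, G y := by
    rw [← Finset.sum_fiberwise univ (fun b : Bond d (fineP L m) => blockCoord L m (bpos b)) (fun b => G (blockCoord L m (bpos b))), mul_sum]
    refine sum_congr rfl fun y _ => ?_
    rw [sum_congr rfl fun b hb => by rw [(mem_filter.1 hb).2], sum_const, card_bonds_based_in_block L m y, nsmul_eq_mul]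
    push_cast; ring
  have hGsum : ∑ y, G y = ((L : ℝ) ^ d)⁻¹ * ∑ x, ‖f x‖ ^ 2 := by
    rw [hG, ← mul_sum, sum_blockOf_sum]
  calc ∑ b : Bond d (fineP L m), ‖Complex.exp (κ * (χ (bpos b) : ℂ)) • covDeriv c R (fun x => (φ x : ℂ) • Ainv (blockCoord L m x) x
          (QprimeLin L m R (fun z => Complex.exp (-(κ * (χ z : ℂ))) • f z) (blockCoord L m x))) b‖ ^ 2
      ≤ ∑ b : Bond d (fineP L m), K ^ 2 * G (blockCoord L m (bpos b)) := sum_le_sum fun b _ => key b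
    _ = K ^ 2 * ((d * (L : ℝ) ^ d) * (((L : ℝ) ^ d)⁻¹ * ∑ x, ‖f x‖ ^ 2)) := by rw [← mul_sum, hfib, hGsum]
    _ = d * K ^ 2 * ∑ x, ‖f x‖ ^ 2 := by field_simp
    _ = d * ((‖c‖ * ℓφ * MT * MA' + Φ * hol) * Real.exp (‖κ‖ * ω) * MA) ^ 2 * ∑ x, ‖f x‖ ^ 2 := by rw [hK]

end Literature.MathematicalPhysics.QuantumFieldTheory.Balaban1983to89.B9Eq319BumpSection

end
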